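import Summits.Parity.GeneralizedHardyLittlewood.Theorems.Dhl42Staircase
import Summits.Parity.GeneralizedHardyLittlewood.Theorems.Dhl42Cover

/-!
# DHL[42,2] certificate — Proposition 5.3 at the §7 instance (`omega_admissible`)

§6 of the package file: the grade data `gradeData42 = (L_g, c_g, (1,2,2))` of Section 7.1, the
sentinel and constant facts, Proposition 5.3(iv) for every grade, the pair condition per grade from
`StaircaseFacts` (`pc_gradeA/B/C`),
`graded_admissible : StaircaseFacts → Admissible gradeData42 rho0 GradedF GradedG`, and
**`omega_admissible : Admissible gradeData42 rho0 OmegaF OmegaG`** (with `staircaseFacts_hold` and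
the reductions `banded_subset_gradedF/G`).

Origin: `Dhl42/Staircase.lean` of the DHL[42,2] certificate package (pub-dhl42 bundle, archive blob
`18cce9e3`; sha256[:16] of the file `6560125ec2016ae9`; paper snapshot = `paper/main.tex` v1), lines
:399–:496; statements and proofs unchanged except: namespace `TpY4Dhl42` →
`Summit.Parity.GeneralizedHardyLittlewood.Theorems.Dhl42`, the package's `simplexSet n B` replaced
by the tree's definitionally equal `Literature.NumberTheory.Sieve.scaledSimplex n B` (also inside
declaration names), docstrings added where missing (the docstring of `omega_admissible` re-worded
for the tree: package-internal pointers removed, mathematics unchanged), `#print axioms` lines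
dropped. Package-internal references in the verbatim docstrings (`Dhl42/….lean`, `Assumed.…`,
`row 9…`, `gen n`, `inputs/COMPARE.md`) refer to that package (paper Appendix B).

Declarations (14; `kc_le_sc` is private): `gradeData42`, `gradeData42_i`, `kc_le_sc`, `levAE_last`,
`levBE_last`, `levCE_last`, `const_A42`, `const_B42`, `cond_iv_all`, `pc_gradeA`, `pc_gradeB`,
`pc_gradeC`, `graded_admissible`, `omega_admissible`.
-/

open Finset

namespace Summit.Parity.GeneralizedHardyLittlewood.Theorems.Dhl42

/-! ### §6. The instance of §7: `(GradedF, GradedG)` and the banded `(OmegaF, OmegaG)` are `ρ₀`-admissible -/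

/-- The grade data of §7.1 (`ss:params42`, Table 1): `L_g`, `c_g` (`TpY4Dhl42.Lg`, `TpY4Dhl42.cg`) and the
multiplicities `(i_A, i_B, i_C) = (1, 2, 2)`. -/
noncomputable def gradeData42 : GradeData 3 := ⟨Lg, cg, ![1, 2, 2]⟩

/-- The multiplicities of the §7.1 grade data are `(i_A, i_B, i_C) = (1, 2, 2)`. -/
theorem gradeData42_i : gradeData42.i 0 = 1 ∧ gradeData42.i 1 = 2 ∧ gradeData42.i 2 = 2 :=
  ⟨rfl, rfl, rfl⟩

/-- `K ≤ S`; a private copy (the public `ClosedForm.Kc_le_Sc` is on the other import chain). -/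
private theorem kc_le_sc : Dhl42.Kc ≤ Dhl42.Sc := by unfold Kc Sc eps; norm_num

/-- The sentinel convention `u^g_{J_g+1} = S + ρ₀` of Proposition 5.3 (last entries of `levAE/BE/CE`). -/
theorem levAE_last : levAE (Fin.last 22) = Sc + rho0 := rfl
/-- The sentinel of grade B: `u^B_{J_B+1} = S + ρ₀` (last entry of `levBE`). -/
theorem levBE_last : levBE (Fin.last 42) = Sc + rho0 := rfl
/-- The sentinel of grade C: `u^C_{J_C+1} = S + ρ₀` (last entry of `levCE`). -/
theorem levCE_last : levCE (Fin.last 46) = Sc + rho0 := rfl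

/-- `A = 2k + 1 = k + k' + 2` and `B = 2k − 1 ≥ 2k'` at `k = 42`, `k' = 41`. -/
theorem const_A42 : ((42 : ℕ) : ℝ) + ((41 : ℕ) : ℝ) + 2 ≤ 2 * 42 + 1 := by norm_num
/-- `2k' ≤ 2k − 1` at `k = 42`, `k' = 41` (the constant `B = 2k − 1` of Proposition 5.3). -/
theorem const_B42 : 2 * ((41 : ℕ) : ℝ) ≤ 2 * 42 - 1 := by norm_num

/-- Proposition 5.3(iv) for every grade (the field `cond_iv` is the case `g = A`; `L_A ≤ L_B, L_C`). -/
theorem cond_iv_all (sf : StaircaseFacts) :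
    ∀ g : Fin 3, 2 * Kc + (2 * 42 - 1) * rho0 < gradeData42.L g - rho0 := by
  have h0 := sf.cond_iv
  have h1 : Lg 0 ≤ Lg 1 := by rw [Lg0_eq, Lg1_eq]; norm_num
  have h2 : Lg 0 ≤ Lg 2 := by rw [Lg0_eq, Lg2_eq]; norm_num
  intro g
  fin_cases g
  · exact h0
  · exact (show 2 * Kc + (2 * 42 - 1) * rho0 < gradeData42.L 1 - rho0 from
      lt_of_lt_of_le h0 (by show Lg 0 - rho0 ≤ Lg 1 - rho0; linarith))
  · exact (show 2 * Kc + (2 * 42 - 1) * rho0 < gradeData42.L 2 - rho0 from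
      lt_of_lt_of_le h0 (by show Lg 0 - rho0 ≤ Lg 2 - rho0; linarith))

/-- Grade A (`i = 1`, 22 levels `levA`, thresholds `tauFA/tauGA`) clause of Definition 4.2(i) for
`(GradedF, GradedG)`, from `pc_clause_of_staircase` and the fields of `StaircaseFacts`. -/
theorem pc_gradeA (sf : StaircaseFacts) {t s : Fin 42 → ℝ} {t' s' : Fin 41 → ℝ}
    (ht : t ∈ GradedF) (ht' : t' ∈ GradedG) (hs : ∀ j, 0 ≤ s j) (hst : ∀ j, |s j - t j| ≤ rho0)
    (hs' : ∀ j, 0 ≤ s' j) (hst' : ∀ j, |s' j - t' j| ≤ rho0) (m : Fin 42)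
    (hsum : gradeData42.L 0 - rho0 ≤ (msetDrop s m).sum + (mset s').sum) :
    ∀ v ∈ msetDrop s m + mset s', gradeData42.c 0 < v →
      Usum (msetDrop s m) v + Usum (mset s') v ≤
        gradeData42.L 0 + gradeData42.c 0 - (gradeData42.i 0 : ℝ) * v - rho0 := by
  intro v hv hcv
  have H := pc_clause_of_staircase (ι := 1) (A := 2 * 42 + 1) sf.rho0_pos kc_le_sc zero_le_one
    const_A42 (sf.cond_i 0) sf.cond_ii.1 sf.cond_iii.1 levAE_last ht.1 ht.2.1 ht'.1 ht'.2.1 hs hst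
    hs' hst' m hsum v hv hcv
  simpa [gradeData42] using H

/-- Grade B (`i = 2`, 42 levels `levB`, thresholds `tauFB/tauGB`). -/
theorem pc_gradeB (sf : StaircaseFacts) {t s : Fin 42 → ℝ} {t' s' : Fin 41 → ℝ}
    (ht : t ∈ GradedF) (ht' : t' ∈ GradedG) (hs : ∀ j, 0 ≤ s j) (hst : ∀ j, |s j - t j| ≤ rho0)
    (hs' : ∀ j, 0 ≤ s' j) (hst' : ∀ j, |s' j - t' j| ≤ rho0) (m : Fin 42)
    (hsum : gradeData42.L 1 - rho0 ≤ (msetDrop s m).sum + (mset s').sum) :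
    ∀ v ∈ msetDrop s m + mset s', gradeData42.c 1 < v →
      Usum (msetDrop s m) v + Usum (mset s') v ≤
        gradeData42.L 1 + gradeData42.c 1 - (gradeData42.i 1 : ℝ) * v - rho0 := by
  intro v hv hcv
  have H := pc_clause_of_staircase (ι := 2) (A := 2 * 42 + 1) sf.rho0_pos kc_le_sc zero_le_two
    const_A42 (sf.cond_i 1) sf.cond_ii.2.1 sf.cond_iii.2.1 levBE_last ht.1 ht.2.2.1 ht'.1 ht'.2.2.1
    hs hst hs' hst' m hsum v hv hcv
  simpa [gradeData42] using H

/-- Grade C (`i = 2`, 46 levels `levC`, thresholds `tauFC/tauGC`). -/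
theorem pc_gradeC (sf : StaircaseFacts) {t s : Fin 42 → ℝ} {t' s' : Fin 41 → ℝ}
    (ht : t ∈ GradedF) (ht' : t' ∈ GradedG) (hs : ∀ j, 0 ≤ s j) (hst : ∀ j, |s j - t j| ≤ rho0)
    (hs' : ∀ j, 0 ≤ s' j) (hst' : ∀ j, |s' j - t' j| ≤ rho0) (m : Fin 42)
    (hsum : gradeData42.L 2 - rho0 ≤ (msetDrop s m).sum + (mset s').sum) :
    ∀ v ∈ msetDrop s m + mset s', gradeData42.c 2 < v →
      Usum (msetDrop s m) v + Usum (mset s') v ≤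
        gradeData42.L 2 + gradeData42.c 2 - (gradeData42.i 2 : ℝ) * v - rho0 := by
  intro v hv hcv
  have H := pc_clause_of_staircase (ι := 2) (A := 2 * 42 + 1) sf.rho0_pos kc_le_sc zero_le_two
    const_A42 (sf.cond_i 2) sf.cond_ii.2.2 sf.cond_iii.2.2 levCE_last ht.1 ht.2.2.2 ht'.1 ht'.2.2.2
    hs hst hs' hst' m hsum v hv hcv
  simpa [gradeData42, Matrix.cons_val_two, Matrix.head_cons, Matrix.tail_cons] using H

/-- **Proposition 5.3 at the instance**: given the side conditions `StaircaseFacts` (PROVED: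
`staircaseFacts_hold`), the pair `(GradedF, GradedG)` of graded staircase regions of Definition 5.2 for the
per-grade data of §7.1 is `ρ₀`-admissible (Definition 4.2) for the grade data `gradeData42`. -/
theorem graded_admissible (sf : StaircaseFacts) : Admissible gradeData42 rho0 GradedF GradedG := by
  refine ⟨?_, fun s' hs' s'' hs'' =>
    pc_of_thicken_simplex gradeData42 (fun t ht => ht.1) const_B42 sf.rho0_pos.le (cond_iv_all sf)
      hs' hs''⟩
  intro s hs s' hs' m g
  obtain ⟨hs0, t, ht, hst⟩ := hs
  obtain ⟨hs0', t', ht', hst'⟩ := hs'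
  fin_cases g
  · exact pc_gradeA sf ht ht' hs0 hst hs0' hst' m
  · exact pc_gradeB sf ht ht' hs0 hst hs0' hst' m
  · exact pc_gradeC sf ht ht' hs0 hst hs0' hst' m

/-- **The regions of the certificate are admissible**: the banded (Table 2) regions
`(OmegaF, OmegaG)` — the `Ω, Ω'` on which `F₀` and the `G_m` of §7 are supported — form a
`ρ₀`-admissible pair, `ρ₀ = 10⁻⁵`, for the grade data of §7.1 (from
`graded_admissible staircaseFacts_hold` and the reductions `banded_subset_gradedF/G` of §7.1, by
`Admissible.mono`). This is the geometric hypothesis of Theorem 4.3 at the instance, consumed by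
`corollary64_of_theorem43` (`Dhl42Theorem43`). -/
theorem omega_admissible : Admissible gradeData42 rho0 OmegaF OmegaG :=
  (graded_admissible staircaseFacts_hold).mono banded_subset_gradedF banded_subset_gradedG

end Summit.Parity.GeneralizedHardyLittlewood.Theorems.Dhl42
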